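import Mathlib
import Summits.CriticalPhenomena.CardyFormulaZ2.Theorems.CardySelfRefinementDefs
import Summits.CriticalPhenomena.CardyFormulaZ2.Theorems.CardySelfRefinementGradientComparabilityStubCornerWindowsDefect
import Summits.CriticalPhenomena.CardyFormulaZ2.Theorems.CardySelfRefinementGradientComparabilityStubDcEqSumPivotal
import Summits.CriticalPhenomena.CardyFormulaZ2.Theorems.CardySelfRefinementCriticalPathRSWStubCone2Russo
import Literature.Probability.LatticeModels.ProdBernoulliIndependence
import HarnessLib

/-!
# Crux `GradientComparability` (stmt-CriticalPhenomena-10269), line `monotone-product-coordinates` —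
# stub `stub_cornerLocalSlope` (LOC), penalty bound (A″_k), part 2: the cheap moves of `M_k(ρ,c)` —
# the own coin of an interior edge, and forcing a bundle open without touching its selector

Route `CardySelfRefinement`, sub-problem `CriticalPhenomena/CardyFormulaZ2`; vocabulary from
`CardySelfRefinementDefs` (`ax tb opn cfg prm M Aloc edgeOf`); bundle surgery and the canonical
enumeration from `…StubCornerWindows{Sections,Defect}` (`cfg_eq_of_agree_off_bundleCoins`,
`bundle_param_canonical`, `coe_bundleFinset_eq_image`), the own coin of an interior edge from
`…StubDcEqSumPivotal` (`cfg_sdiff_own`), one-coordinate sections of `prodBernoulli`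
(`Cone2.prodBernoulli_real_eq_sections`).

## Mathematics

The local corner slope bound (LOC) charges the defects of the corner dictionary
(`Drho_eq_sum_half_pivotal_sub_defect`) to pivotal bundles and pivotal interior edges using only
moves whose cost is uniform in `ρ ∈ [0,1]` (no `1/(1−ρ)` of the generic single-edge finite energy
`M_real_insert_le_and_sdiff_le`): for `E = Aloc m F η`, a bundle `B`, an interior edge `g ∉ B`,

* `defect_inter_subset` — **charging** (pure set theory, `E` increasing, `J ⊆ B`): on
  `A^J ∖ A^∅ ∩ {g open}`, either `ω ∖ {g}` is `B`-set-pivotal, or `g` is pivotal for `E` in `ω ∪ B`;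
* `real_mem_and_sdiff_mem_eq`, `one_sub_mul_real_sdiff_mem_le` — **the own coin of an interior
  edge is an independent coin of bias `c`**: `M{g open, ω ∖ g ∈ X} = c · M{ω ∖ g ∈ X}` and
  `(1 − c) · M{ω ∖ g ∈ X} ≤ M(X)` (closing an interior edge costs `1/(1−c)`);
* `prodBernoulli_real_union_le_two_pow`, `real_isPivotal_union_bundle_le` (registered) — **forcing a
  bundle open costs `2^{k+1}`**: the shared coin ON and the `k` own coins ON open every sub-edge
  whatever the selector says (`cfg_eq_of_agree_off_bundleCoins`), and forcing `n` fair coins on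
  costs `2^n`, so `M{g pivotal in ω ∪ B} ≤ 2^{k+1} · M{g pivotal in ω}` at every `(ρ, c)`, the
  corner `ρ = 1` included.

Part 3 (`…StubSlopeBoundsCornerPatterns`) combines these with part 1 (a proper pattern of a far
bundle crosses only through an open interior edge) into the penalty bound with its factor `c`.
-/

noncomputable section

namespace Summit.CriticalPhenomena.CardyFormulaZ2.Theorems.CardySelfRefinement

open scoped Topology
open Filter Set MeasureTheory
open Literature.Probability.LatticeModels Literature.Probability.Percolation
open Literature.Probability.Percolation.QuadCrossing
open Summit.CriticalPhenomena.CardyFormulaZ2.Theses.CardySelfRefinement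

/-! ## Charging a defect configuration to an open edge outside the bundle -/

/-- **Charging.**  Let `E` be increasing, `J ⊆ B` edge sets and `g ∉ B`.  If the pattern `J`
creates the event on the rest of `ω` (`(ω ∖ B) ∪ J ∈ E`, `ω ∖ B ∉ E`) and `g` is open in `ω`, then
either `ω ∖ {g}` is still `B`-set-pivotal, or `g` is pivotal for `E` once `B` is forced open. -/
theorem defect_inter_subset {E : Set (BondConfig (Site 2))} (hE : IsUpperSet E)
    {B J : Set (Sym2 (Site 2))} (hJ : J ⊆ B) {g : Sym2 (Site 2)} (hg : g ∉ B) :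
    ({ω | ω \ B ∪ J ∈ E} \ {ω | ω \ B ∈ E}) ∩ {ω | g ∈ ω} ⊆
      {ω | g ∈ ω ∧ ω \ {g} ∈ {ω' | ω' ∪ B ∈ E ∧ ω' \ B ∉ E}} ∪
        {ω | g ∈ ω ∧ ω \ {g} ∈ {ω' | IsPivotal E g (ω' ∪ B)}} := by
  rintro ω ⟨⟨h1, h2⟩, hgω⟩
  simp only [Set.mem_setOf_eq] at h1 h2 hgω
  by_cases h : ω \ {g} ∪ B ∈ E
  · left
    refine ⟨hgω, h, fun h' => h2 (hE ?_ h')⟩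
    exact Set.sdiff_subset_sdiff_left Set.sdiff_subset
  · right
    refine ⟨hgω, Or.inl ⟨?_, ?_⟩⟩
    · refine hE ?_ h1
      rintro e (⟨heω, -⟩ | heJ)
      · by_cases hge : e = g
        · exact hge ▸ Set.mem_insert _ _
        · exact Set.mem_insert_of_mem _ (Or.inl ⟨heω, hge⟩)
      · exact Set.mem_insert_of_mem _ (Or.inr (hJ heJ))
    · have hset : (ω \ {g} ∪ B) \ {g} = ω \ {g} ∪ B := by
        ext e
        simp only [Set.mem_sdiff, Set.mem_union, Set.mem_singleton_iff]
        constructor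
        · rintro ⟨h', -⟩
          exact h'
        · rintro (⟨heω, hne⟩ | heB)
          · exact ⟨Or.inl ⟨heω, hne⟩, hne⟩
          · exact ⟨Or.inr heB, fun hge => hg (hge ▸ heB)⟩
      rw [hset]
      exact h

/-- Pivotality of `g` does not depend on the state of `g`: closing `g` first changes nothing. -/
theorem isPivotal_sdiff_singleton_iff {α : Type*} (A : Set (Set α)) (g : α) (ω : Set α) :
    IsPivotal A g (ω \ {g}) ↔ IsPivotal A g ω := by
  simp only [IsPivotal, Set.insert_sdiff_singleton, sdiff_idem]

/-! ## Cheap moves of `M_k(ρ,c)`: the own coin of an interior edge, and forcing a bundle open -/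

/-- **The state of an interior edge is an independent coin.**  For a non-axial `(v, d)`,
`g = edgeOf (v, d)`, and measurable `E`: `M{g open ∧ ω ∖ {g} ∈ E} = p · M{ω ∖ {g} ∈ E}`,
`p` the (clamped) bias `c` of the own coin of `g`. -/
theorem real_mem_and_sdiff_mem_eq (k : ℕ) {v : Site 2} {d : Fin 2} (hax : ¬ ax k (v, d)) (ρ c : ℝ)
    {E : Set (BondConfig (Site 2))} (hE : MeasurableSet E) :
    (M k ρ c).real {ω | edgeOf (v, d) ∈ ω ∧ ω \ {edgeOf (v, d)} ∈ E} =
      (prm k ρ c (v, d, 0) : ℝ) * (M k ρ c).real {ω | ω \ {edgeOf (v, d)} ∈ E} := by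
  set i : Site 2 × Fin 2 × Fin 3 := (v, d, (0 : Fin 3)) with hi
  have hm1 : MeasurableSet {ω : BondConfig (Site 2) | ω \ {edgeOf (v, d)} ∈ E} :=
    measurable_sdiff_pt _ hE
  have hm2 : MeasurableSet {ω : BondConfig (Site 2) | edgeOf (v, d) ∈ ω ∧ ω \ {edgeOf (v, d)} ∈ E} :=
    (measurableSet_setOf.2 (measurable_set_mem _)).inter hm1
  have hpre : (cfg k) ⁻¹' {ω | edgeOf (v, d) ∈ ω ∧ ω \ {edgeOf (v, d)} ∈ E} =
      {S | i ∈ S} ∩ {S | S \ {i} ∈ (cfg k) ⁻¹' E} := by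
    ext S
    rw [Set.mem_preimage, Set.mem_setOf_eq, edgeOf_mem_cfg_iff_opn, ← cfg_sdiff_own k S hax]
    simp only [Set.mem_setOf_eq, Set.mem_inter_iff, Set.mem_preimage, opn, if_neg hax, hi]
  have hpre2 : (cfg k) ⁻¹' {ω | ω \ {edgeOf (v, d)} ∈ E} = {S | S \ {i} ∈ (cfg k) ⁻¹' E} := by
    ext S
    simp only [Set.mem_preimage, Set.mem_setOf_eq, hi, cfg_sdiff_own k S hax]
  rw [map_measureReal_apply (measurable_cfg k) hm2, map_measureReal_apply (measurable_cfg k) hm1, hpre,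
    hpre2, prodBernoulli_real_inter_of_determinedBy _ {i} (determinedBy_setOf_mem_singleton i)
      (Cruxes.CriticalPathRSW.FiniteSizeEnvelope.Cone2.determinedBy_setOf_sdiff_mem_compl _ i)
      (measurableSet_setOf.2 (measurable_set_mem i))
      (Cruxes.CriticalPathRSW.FiniteSizeEnvelope.Cone2.measurableSet_setOf_sdiff_mem (measurable_cfg k hE) i),
    prodBernoulli_real_setOf_mem]

/-- **Closing an interior edge costs `1/(1-c)`**: `(1 - p) · M{ω ∖ {g} ∈ E} ≤ M(E)`. -/
theorem one_sub_mul_real_sdiff_mem_le (k : ℕ) {v : Site 2} {d : Fin 2} (hax : ¬ ax k (v, d)) (ρ c : ℝ)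
    {E : Set (BondConfig (Site 2))} (hE : MeasurableSet E) :
    (1 - (prm k ρ c (v, d, 0) : ℝ)) * (M k ρ c).real {ω | ω \ {edgeOf (v, d)} ∈ E} ≤ (M k ρ c).real E := by
  set i : Site 2 × Fin 2 × Fin 3 := (v, d, (0 : Fin 3)) with hi
  have hm1 : MeasurableSet {ω : BondConfig (Site 2) | ω \ {edgeOf (v, d)} ∈ E} :=
    measurable_sdiff_pt _ hE
  have hpre2 : (cfg k) ⁻¹' {ω | ω \ {edgeOf (v, d)} ∈ E} = {S | S \ {i} ∈ (cfg k) ⁻¹' E} := by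
    ext S
    simp only [Set.mem_preimage, Set.mem_setOf_eq, hi, cfg_sdiff_own k S hax]
  have hM : (M k ρ c).real E = (prodBernoulli (prm k ρ c)).real ((cfg k) ⁻¹' E) :=
    map_measureReal_apply (measurable_cfg k) hE
  have hsec := Cruxes.CriticalPathRSW.FiniteSizeEnvelope.Cone2.prodBernoulli_real_eq_sections
    (prm k ρ c) (measurable_cfg k hE) i
  rw [map_measureReal_apply (measurable_cfg k) hm1, hpre2, hM, hsec]
  have h0 : 0 ≤ (prodBernoulli (prm k ρ c)).real {ω | insert i ω ∈ (cfg k) ⁻¹' E} := measureReal_nonneg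
  nlinarith [(prm k ρ c i).2.1]

/-- **Forcing fair coins on costs a factor `2` each**: if every coin of `C` has bias `½`, then
`P{S | S ∪ C ∈ A} ≤ 2^{#C} · P(A)`. -/
theorem prodBernoulli_real_union_le_two_pow (p : Site 2 × Fin 2 × Fin 3 → unitInterval)
    (C : Finset (Site 2 × Fin 2 × Fin 3)) (hC : ∀ i ∈ C, (p i : ℝ) = 1 / 2)
    {A : Set (Set (Site 2 × Fin 2 × Fin 3))} (hA : MeasurableSet A) :
    (prodBernoulli p).real {S | S ∪ ↑C ∈ A} ≤ 2 ^ C.card * (prodBernoulli p).real A := by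
  classical
  induction C using Finset.induction_on generalizing A with
  | empty => simp
  | insert a C haC ih =>
    have hset : {S : Set (Site 2 × Fin 2 × Fin 3) | S ∪ ↑(insert a C) ∈ A} =
        {S | S ∪ ↑C ∈ {T | insert a T ∈ A}} := by
      ext S
      simp only [Set.mem_setOf_eq, Finset.coe_insert, Set.union_insert]
    have hA' : MeasurableSet {T : Set (Site 2 × Fin 2 × Fin 3) | insert a T ∈ A} :=
      Cruxes.CriticalPathRSW.FiniteSizeEnvelope.Cone2.measurableSet_setOf_insert_mem hA a
    rw [hset, Finset.card_insert_of_notMem haC, pow_succ]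
    refine (ih (fun i hi => hC i (Finset.mem_insert_of_mem hi)) hA').trans ?_
    have hsec := Cruxes.CriticalPathRSW.FiniteSizeEnvelope.Cone2.prodBernoulli_real_eq_sections p hA a
    rw [hC a (Finset.mem_insert_self a C)] at hsec
    have h0 : 0 ≤ (prodBernoulli p).real {ω | ω \ {a} ∈ A} := measureReal_nonneg
    have h2 : (prodBernoulli p).real {T | insert a T ∈ A} ≤ 2 * (prodBernoulli p).real A := by linarith
    calc (2 : ℝ) ^ C.card * (prodBernoulli p).real {T | insert a T ∈ A}
        ≤ 2 ^ C.card * (2 * (prodBernoulli p).real A) := by gcongr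
      _ = 2 ^ C.card * 2 * (prodBernoulli p).real A := by ring

/-- **Forcing a bundle open costs at most `2^{k+1}`** (registered helper; shared coin ON and the `k` own coins ON — the
selector is untouched, so the move is uniform in `ρ`, the corner `ρ = 1` included): for `0 < k`,
`η ≠ 0`, any `ρ, c`, the bundle `B` of `(t, d)` and any edge `g`,
`M{ω | g pivotal for Aloc in ω ∪ B} ≤ 2^{k+1} · M{ω | g pivotal for Aloc in ω}`. -/
theorem real_isPivotal_union_bundle_le : ∀ (k m : ℕ), 0 < k → ∀ (F : Fin m → Quad (Set.univ : Set ℂ)) {η : ℝ}, η ≠ 0 → ∀ (ρ c : ℝ) (t : Site 2) (d : Fin 2) (g : Sym2 (Site 2)), (M k ρ c).real {ω | IsPivotal (Aloc m F η) g (ω ∪ edgeOf '' {vd : Site 2 × Fin 2 | ax k vd ∧ tb k vd = t ∧ vd.2 = d})} ≤ 2 ^ (k + 1) * (M k ρ c).real {ω | IsPivotal (Aloc m F η) g ω} := by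
  intro k m hk F η hη ρ c t d g
  classical
  obtain ⟨hw₁, hw₂, hw₃⟩ := bundle_param_canonical hk t d
  set w : ℕ → Site 2 := fun j l => (k : ℤ) * t l + if l = d then (j : ℤ) else 0 with hw
  set B : Finset (Sym2 (Site 2)) := (Finset.range k).image fun j => edgeOf (w j, d) with hB
  have hBset := coe_bundleFinset_eq_image k (w := w) hw₁ hw₂ hB
  set E' : Set (BondConfig (Site 2)) := {ω | IsPivotal (Aloc m F η) g ω} with hE'
  have hE'm : MeasurableSet E' := measurableSet_setOf_isPivotal (measurableSet_Aloc m F hη) g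
  set C : Finset (Site 2 × Fin 2 × Fin 3) :=
    insert (t, d, (1 : Fin 3)) ((Finset.range k).image fun j => (w j, d, (0 : Fin 3))) with hC
  have hcfg : ∀ S : Set (Site 2 × Fin 2 × Fin 3), cfg k (S ∪ ↑C) = cfg k S ∪ ↑B := by
    intro S
    have h := cfg_eq_of_agree_off_bundleCoins k hw₂ hw₃ hB (S := S) (S' := S ∪ ↑C)
      (fun x hx2 hx1 hx0 => ?_) (fun _ => True) (fun j hj => ?_)
    · rw [h, Finset.filter_true_of_mem fun _ _ => trivial, ← hB, Set.sdiff_union_self]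
    · simp only [Set.mem_union, Finset.mem_coe, hC, Finset.mem_insert, Finset.mem_image, Finset.mem_range,
        or_iff_left_iff_imp]
      rintro (h1 | ⟨j, hj, rfl⟩)
      · exact absurd h1 hx1
      · exact absurd rfl (hx0 j hj)
    · refine (opn_subEdge k (w := w) (j := j) (hw₁ j hj) (S ∪ ↑C)).trans ?_
      have hsh : (t, d, (1 : Fin 3)) ∈ S ∪ ↑C := Or.inr (by simp [hC])
      have hown : (w j, d, (0 : Fin 3)) ∈ S ∪ ↑C :=
        Or.inr (by simp only [hC, Finset.coe_insert, Finset.coe_image, Set.mem_insert_iff, Set.mem_image,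
          Finset.mem_coe, Finset.mem_range]; exact Or.inr ⟨j, hj, rfl⟩)
      simp only [hsh, hown, and_true, iff_true]
      exact em _
  have hm : MeasurableSet {ω : BondConfig (Site 2) | IsPivotal (Aloc m F η) g (ω ∪ ↑B)} :=
    (measurable_set_iff.2 fun x => (measurable_set_mem x).or measurable_const :
      Measurable fun ω : BondConfig (Site 2) => ω ∪ ↑B) hE'm
  have hpre : (cfg k) ⁻¹' {ω : BondConfig (Site 2) | IsPivotal (Aloc m F η) g (ω ∪ ↑B)} =
      {S | S ∪ ↑C ∈ (cfg k) ⁻¹' E'} := by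
    ext S
    simp only [Set.mem_preimage, Set.mem_setOf_eq, hcfg S, hE']
  have hcard : C.card ≤ k + 1 := by
    rw [hC]
    refine (Finset.card_insert_le _ _).trans ?_
    simpa using Finset.card_image_le (s := Finset.range k) (f := fun j => (w j, d, (0 : Fin 3)))
  have hhalf : ∀ i ∈ C, (prm k ρ c i : ℝ) = 1 / 2 := by
    intro i hi
    simp only [hC, Finset.mem_insert, Finset.mem_image, Finset.mem_range] at hi
    rcases hi with rfl | ⟨j, hj, rfl⟩
    · simp [prm]
    · have hax' : ax k (w j, d) := (hw₁ j hj).1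
      simp [prm, hax']
  rw [← hBset, map_measureReal_apply (measurable_cfg k) hm, map_measureReal_apply (measurable_cfg k) hE'm, hpre]
  refine (prodBernoulli_real_union_le_two_pow (prm k ρ c) C hhalf (measurable_cfg k hE'm)).trans ?_
  have h0 : 0 ≤ (prodBernoulli (prm k ρ c)).real ((cfg k) ⁻¹' E') := measureReal_nonneg
  exact mul_le_mul_of_nonneg_right (pow_le_pow_right₀ (by norm_num) hcard) h0

end Summit.CriticalPhenomena.CardyFormulaZ2.Theorems.CardySelfRefinement

end
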